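import Mathlib
import Summits.KontsevichZagierPeriods.Zeta5Search.CellularZetaFiveZeroSteps
import Summits.KontsevichZagierPeriods.Zeta5Search.InvarianceGroup
import Literature.NumberTheory.Irrationality.BrownZudilin2022.TotallySymmetricDecomposition
import Literature.Analysis.Complex.ExtremalLength
import HarnessLib

/-!
# Brown–Zudilin's base value `I₀ = 2ζ(5) + 4ζ(3)ζ(2)`, II: the 5-fold assembly — `Isym 0 = zeta5hat`
# (cell `pub-zeta5`, seat ct-1 g21; the `n = 0` clause of the named fact `I_init` [BrownZudilin2022, Sect. 2 (5)])

HONEST FRAMING: systematic search; no irrationality claim unless certified.  An exact EVALUATION of Brown–Zudilin's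
absolutely convergent 5-fold cellular integral (1) at `a = (0,…,0)`:
**`Isym_zero : Isym 0 = zeta5hat`**, i.e. `∫_{0<t₁<⋯<t₅<1} dt/((t₃−t₁)t₃(1−t₄)(t₄−t₂)(t₅−t₂)) = 2ζ(5) + 4ζ(3)ζ(2)`
(`cellularIntegral_zero` for the literal vector), the `n = 0` clause of the Literature named fact `I_init` (the source's
HyperInt value), by elementary calculus: Tonelli through `MeasureTheory.lmarginal` (as in `WedgeDictionaryTopPairIntegral`,
`WedgeDictionaryOneTopIntegral`) over the one-variable steps of `CellularZetaFiveZeroSteps` in the order `t₁, t₅, t₃`,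
substitution `t₂ = t₄·y` (the tree's `ExtremalLength.lintegral_Ioo_comp_mul`), `t₄`, `y`.  With ct-1 g20's
`I_init_iff : I_init ↔ (Isym 0 = zeta5hat ∧ explicitPQ)` (staged `WedgeDictionaryDiagonalDecomposition`) and the one-top
datum (`WedgeDictionaryOneTopIntegral` ⇒ `explicitPQ` via `explicitPQ_iff_oneTop`), this discharges `I_init` and, through
`I_solvesRec_of_I_init`, the recursion `I_solvesRec` — both stay NAMED FACTS until those files land; nothing here asserts
them.  The integrand and the partially integrated functions are LOCAL NOTATIONS (theorems only).  `ζ(5)` is the value of a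
convergent integral; nothing about irrationality, no linear form, no `γ`; records in print unmoved.
-/

noncomputable section

open MeasureTheory Set Filter Topology intervalIntegral
open scoped ENNReal

namespace Summit.KontsevichZagierPeriods.Zeta5Search.CellularZetaFiveZero

open Literature.Analysis.SpecialFunctions (reDilog continuous_reDilog)
open Literature.NumberTheory.Transcendental (zetaValue)
open Literature.NumberTheory.Irrationality.BrownZudilin2022 (integrand cellularIntegral openSimplex b24 b14 b57 b35 b36
  Isym zeta5hat)
open Summit.KontsevichZagierPeriods.Zeta5Search.InvarianceGroup (measurableSet_openSimplex')

/-! ## 1. The integrand at `a = 0` and the chain of partially integrated functions -/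

/-- The integrand of (1) at `a = 0`: `1/((t₃−t₁) t₃ (1−t₄)(t₄−t₂)(t₅−t₂))` (local notation). -/
local notation "f0" => (fun t : Fin 5 → ℝ => 1 / ((t 2 - t 0) * t 2 * (1 - t 3) * (t 3 - t 1) * (t 4 - t 1)))

/-- The integrand of (1) at `a = 0` IS `f0`. [folklore] -/
theorem integrand_zero (t : Fin 5 → ℝ) : integrand (fun _ => ((0 : ℕ) : ℤ)) t = f0 t := by
  unfold integrand b24 b14 b57 b35 b36
  simp

/-- `f0` is measurable. [folklore] -/
theorem measurable_f0 : Measurable f0 := by fun_prop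

/-- The extended integrand in `ℝ≥0∞` (local notation). -/
local notation "F0" => (Set.indicator openSimplex (fun t : Fin 5 → ℝ => ENNReal.ofReal (f0 t)))

/-- `F0` is measurable. [folklore] -/
theorem measurable_F0 : Measurable F0 :=
  (ENNReal.measurable_ofReal.comp measurable_f0).indicator measurableSet_openSimplex'

/-- After the `t₁`-integration (local notation). -/
local notation "G1" => (fun x : Fin 5 → ℝ =>
  ite (0 < x 1 ∧ x 1 < x 2 ∧ x 2 < x 3 ∧ x 3 < x 4 ∧ x 4 < 1)
    (ENNReal.ofReal (Real.log (x 2 / (x 2 - x 1)) / (x 2 * (1 - x 3) * (x 3 - x 1) * (x 4 - x 1)))) (0 : ENNReal))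

/-- After the `t₅`-integration (local notation). -/
local notation "G2" => (fun x : Fin 5 → ℝ =>
  ite (0 < x 1 ∧ x 1 < x 2 ∧ x 2 < x 3 ∧ x 3 < 1)
    (ENNReal.ofReal (Real.log (x 2 / (x 2 - x 1)) * Real.log ((1 - x 1) / (x 3 - x 1)) /
      (x 2 * (1 - x 3) * (x 3 - x 1)))) (0 : ENNReal))

/-- After the `t₃`-integration (local notation). -/
local notation "G3" => (fun x : Fin 5 → ℝ =>
  ite (0 < x 1 ∧ x 1 < x 3 ∧ x 3 < 1)
    (ENNReal.ofReal ((Real.pi ^ 2 / 6 - reDilog (x 1 / x 3)) * Real.log ((1 - x 1) / (x 3 - x 1)) /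
      ((1 - x 3) * (x 3 - x 1)))) (0 : ENNReal))

/-- After the substitution `t₂ = t₄·y` (local notation). -/
local notation "G4" => (fun x : Fin 5 → ℝ =>
  ite ((0 < x 1 ∧ x 1 < 1) ∧ 0 < x 3 ∧ x 3 < 1)
    (ENNReal.ofReal ((Real.pi ^ 2 / 6 - reDilog (x 1)) / (1 - x 1) *
      (Real.log ((1 - x 3 * x 1) / (x 3 * (1 - x 1))) / (1 - x 3)))) (0 : ENNReal))

/-- After the `t₄`-integration (local notation). -/
local notation "G5" => (fun x : Fin 5 → ℝ =>
  ite (0 < x 1 ∧ x 1 < 1)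
    (ENNReal.ofReal ((Real.pi ^ 2 / 6 - reDilog (x 1)) / (1 - x 1) *
      (Real.pi ^ 2 / 6 + reDilog (x 1) + Real.log (1 - x 1) ^ 2 / 2))) (0 : ENNReal))

/-- `G1` is measurable. [folklore] -/
theorem measurable_G1 : Measurable G1 := by
  refine Measurable.ite ?_ (by fun_prop) measurable_const
  measurability

/-- `G2` is measurable. [folklore] -/
theorem measurable_G2 : Measurable G2 := by
  refine Measurable.ite ?_ (by fun_prop) measurable_const
  measurability

/-- `G3` is measurable. [folklore] -/
theorem measurable_G3 : Measurable G3 := by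
  have h : Continuous reDilog := continuous_reDilog
  refine Measurable.ite ?_ (by fun_prop) measurable_const
  measurability

/-- `G4` is measurable. [folklore] -/
theorem measurable_G4 : Measurable G4 := by
  have h : Continuous reDilog := continuous_reDilog
  refine Measurable.ite ?_ (by fun_prop) measurable_const
  measurability

/-! ## 2. The one-variable steps -/

/-- Step 0 (`t₁ ∈ (0, t₂)`, kernel `1/(t₃−t₁)`). [folklore] -/
theorem step0 (x : Fin 5 → ℝ) : ∫⁻ s, F0 (Function.update x 0 s) = G1 x := by
  obtain ⟨h10, h20, h30, h40⟩ : (1 : Fin 5) ≠ 0 ∧ (2 : Fin 5) ≠ 0 ∧ (3 : Fin 5) ≠ 0 ∧ (4 : Fin 5) ≠ 0 := by decide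
  by_cases hC : 0 < x 1 ∧ x 1 < x 2 ∧ x 2 < x 3 ∧ x 3 < x 4 ∧ x 4 < 1
  · obtain ⟨h1, h12, h23, h34, h4⟩ := hC
    obtain ⟨d2, d3, d31, d41⟩ : 0 < x 2 ∧ 0 < 1 - x 3 ∧ 0 < x 3 - x 1 ∧ 0 < x 4 - x 1 :=
      ⟨by linarith, by linarith, by linarith, by linarith⟩
    set K : ℝ := 1 / (x 2 * (1 - x 3) * (x 3 - x 1) * (x 4 - x 1)) with hKdef
    have hK : 0 ≤ K := by positivity
    have hfun : (fun s => F0 (Function.update x 0 s)) =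
        (Ioo 0 (x 1)).indicator (fun s => ENNReal.ofReal (K * (1 / (x 2 - s)))) := by
      funext s
      simp only [Set.indicator_apply, openSimplex, Set.mem_setOf_eq, Set.mem_Ioo,
        Function.update_self, Function.update_of_ne h10, Function.update_of_ne h20,
        Function.update_of_ne h30, Function.update_of_ne h40]
      by_cases hs : 0 < s ∧ s < x 1
      · rw [if_pos ⟨hs.1, hs.2, h12, h23, h34, h4⟩, if_pos hs]
        congr 1
        have hs2 : x 2 - s ≠ 0 := by linarith [hs.2]
        rw [hKdef]
        field_simp
      · rw [if_neg (fun h => hs ⟨h.1, h.2.1⟩), if_neg hs]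
    rw [hfun, lintegral_indicator measurableSet_Ioo, lintegral_inv_sub h1 h12 hK]
    simp only [if_pos (⟨h1, h12, h23, h34, h4⟩ : 0 < x 1 ∧ x 1 < x 2 ∧ x 2 < x 3 ∧ x 3 < x 4 ∧ x 4 < 1)]
    congr 1
    rw [hKdef]
    ring
  · have hfun : (fun s => F0 (Function.update x 0 s)) = fun _ => 0 := by
      funext s
      simp only [Set.indicator_apply, openSimplex, Set.mem_setOf_eq,
        Function.update_self, Function.update_of_ne h10, Function.update_of_ne h20,
        Function.update_of_ne h30, Function.update_of_ne h40]
      rw [if_neg]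
      intro h
      exact hC ⟨h.1.trans h.2.1, h.2.2⟩
    rw [hfun, lintegral_zero]; simp only [if_neg hC]

/-- Step 1 (`t₅ ∈ (t₄, 1)`, kernel `1/(t₅−t₂)`). [folklore] -/
theorem step1 (x : Fin 5 → ℝ) : ∫⁻ s, G1 (Function.update x 4 s) = G2 x := by
  obtain ⟨h14, h24, h34⟩ : (1 : Fin 5) ≠ 4 ∧ (2 : Fin 5) ≠ 4 ∧ (3 : Fin 5) ≠ 4 := by decide
  by_cases hC : 0 < x 1 ∧ x 1 < x 2 ∧ x 2 < x 3 ∧ x 3 < 1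
  · obtain ⟨h1, h12, h23, h3⟩ := hC
    obtain ⟨d2, d3, d31⟩ : 0 < x 2 ∧ 0 < 1 - x 3 ∧ 0 < x 3 - x 1 := ⟨by linarith, by linarith, by linarith⟩
    have h13 : x 1 < x 3 := h12.trans h23
    have hL := log_div_sub_nonneg h1 h12
    set K : ℝ := Real.log (x 2 / (x 2 - x 1)) / (x 2 * (1 - x 3) * (x 3 - x 1)) with hKdef
    have hK : 0 ≤ K := by positivity
    have hfun : (fun s => G1 (Function.update x 4 s)) =
        (Ioo (x 3) 1).indicator (fun s => ENNReal.ofReal (K * (1 / (s - x 1)))) := by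
      funext s
      simp only [Set.indicator_apply, Set.mem_Ioo, Function.update_self, Function.update_of_ne h14,
        Function.update_of_ne h24, Function.update_of_ne h34]
      by_cases hs : x 3 < s ∧ s < 1
      · rw [if_pos ⟨h1, h12, h23, hs.1, hs.2⟩, if_pos hs]
        congr 1
        have hs1 : s - x 1 ≠ 0 := by linarith [hs.1]
        rw [hKdef]
        field_simp
      · rw [if_neg (fun h => hs ⟨h.2.2.2.1, h.2.2.2.2⟩), if_neg hs]
    rw [hfun, lintegral_indicator measurableSet_Ioo, lintegral_inv_sub' h13 h3 hK]
    simp only [if_pos (⟨h1, h12, h23, h3⟩ : 0 < x 1 ∧ x 1 < x 2 ∧ x 2 < x 3 ∧ x 3 < 1)]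
    congr 1
    rw [hKdef]
    ring
  · have hfun : (fun s => G1 (Function.update x 4 s)) = fun _ => 0 := by
      funext s
      simp only [Function.update_self, Function.update_of_ne h14, Function.update_of_ne h24,
        Function.update_of_ne h34]
      rw [if_neg]
      intro h
      exact hC ⟨h.1, h.2.1, h.2.2.1, h.2.2.2.1.trans h.2.2.2.2⟩
    rw [hfun, lintegral_zero]; simp only [if_neg hC]

/-- Step 2 (`t₃ ∈ (t₂, t₄)`, kernel `log(t₃/(t₃−t₂))/t₃` — the dilogarithm enters). [folklore] -/
theorem step2 (x : Fin 5 → ℝ) : ∫⁻ s, G2 (Function.update x 2 s) = G3 x := by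
  obtain ⟨h12, h32⟩ : (1 : Fin 5) ≠ 2 ∧ (3 : Fin 5) ≠ 2 := by decide
  by_cases hC : 0 < x 1 ∧ x 1 < x 3 ∧ x 3 < 1
  · obtain ⟨h1, h13, h3⟩ := hC
    obtain ⟨d3, d31⟩ : 0 < 1 - x 3 ∧ 0 < x 3 - x 1 := ⟨by linarith, by linarith⟩
    have hL := log_div_sub_nonneg' h13 h3
    set K : ℝ := Real.log ((1 - x 1) / (x 3 - x 1)) / ((1 - x 3) * (x 3 - x 1)) with hKdef
    have hK : 0 ≤ K := by positivity
    have hfun : (fun s => G2 (Function.update x 2 s)) =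
        (Ioo (x 1) (x 3)).indicator (fun s => ENNReal.ofReal (K * (Real.log (s / (s - x 1)) / s))) := by
      funext s
      simp only [Set.indicator_apply, Set.mem_Ioo, Function.update_self, Function.update_of_ne h12,
        Function.update_of_ne h32]
      by_cases hs : x 1 < s ∧ s < x 3
      · rw [if_pos ⟨h1, hs.1, hs.2, h3⟩, if_pos hs]
        congr 1
        have hs0 : s ≠ 0 := by linarith [hs.1]
        rw [hKdef]
        field_simp
      · rw [if_neg (fun h => hs ⟨h.2.1, h.2.2.1⟩), if_neg hs]
    rw [hfun, lintegral_indicator measurableSet_Ioo, lintegral_log_div h1 h13 hK]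
    simp only [if_pos (⟨h1, h13, h3⟩ : 0 < x 1 ∧ x 1 < x 3 ∧ x 3 < 1)]
    congr 1
    rw [hKdef]
    ring
  · have hfun : (fun s => G2 (Function.update x 2 s)) = fun _ => 0 := by
      funext s
      simp only [Function.update_self, Function.update_of_ne h12, Function.update_of_ne h32]
      rw [if_neg]
      intro h
      exact hC ⟨h.1, h.2.1.trans h.2.2.1, h.2.2.2⟩
    rw [hfun, lintegral_zero]; simp only [if_neg hC]

/-- Linear change of variables `∫⁻_{(0,c)} g = ∫⁻_{(0,1)} c·g(c·u) du` (`c > 0`), from the tree's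
`ExtremalLength.lintegral_Ioo_comp_mul`. [folklore] -/
private theorem lintegral_subst {c : ℝ} (hc : 0 < c) (g : ℝ → ℝ≥0∞) :
    ∫⁻ s in Ioo 0 c, g s = ∫⁻ u in Ioo (0:ℝ) 1, ENNReal.ofReal c * g (c * u) := by
  rw [lintegral_const_mul' _ _ ENNReal.ofReal_ne_top, Literature.Analysis.Complex.ExtremalLength.lintegral_Ioo_comp_mul g hc,
    ← mul_assoc, ← ENNReal.ofReal_mul hc.le, mul_inv_cancel₀ hc.ne', ENNReal.ofReal_one, one_mul]

/-- Step 3: the substitution `t₂ = t₄·y` in the `t₂`-integral. [folklore] -/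
theorem step3 (x : Fin 5 → ℝ) : ∫⁻ s, G3 (Function.update x 1 s) = ∫⁻ s, G4 (Function.update x 1 s) := by
  have h31 : (3 : Fin 5) ≠ 1 := by decide
  by_cases hC : 0 < x 3 ∧ x 3 < 1
  · obtain ⟨h3, h3'⟩ := hC
    have hfun3 : (fun s => G3 (Function.update x 1 s)) = (Ioo 0 (x 3)).indicator (fun s => ENNReal.ofReal
        ((Real.pi ^ 2 / 6 - reDilog (s / x 3)) * Real.log ((1 - s) / (x 3 - s)) / ((1 - x 3) * (x 3 - s)))) := by
      funext s
      simp only [Set.indicator_apply, Set.mem_Ioo, Function.update_self, Function.update_of_ne h31]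
      by_cases hs : 0 < s ∧ s < x 3
      · rw [if_pos ⟨hs.1, hs.2, h3'⟩, if_pos hs]
      · rw [if_neg (fun h => hs ⟨h.1, h.2.1⟩), if_neg hs]
    have hfun4 : (fun s => G4 (Function.update x 1 s)) = (Ioo (0:ℝ) 1).indicator (fun s => ENNReal.ofReal
        ((Real.pi ^ 2 / 6 - reDilog s) / (1 - s) * (Real.log ((1 - x 3 * s) / (x 3 * (1 - s))) / (1 - x 3)))) := by
      funext s
      simp only [Set.indicator_apply, Set.mem_Ioo, Function.update_self, Function.update_of_ne h31]
      by_cases hs : 0 < s ∧ s < 1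
      · rw [if_pos ⟨hs, h3, h3'⟩, if_pos hs]
      · rw [if_neg (fun h => hs h.1), if_neg hs]
    rw [hfun3, hfun4, lintegral_indicator measurableSet_Ioo, lintegral_indicator measurableSet_Ioo, lintegral_subst h3]
    refine setLIntegral_congr_fun measurableSet_Ioo fun u hu => ?_
    have hu1 : 1 - u ≠ 0 := by linarith [hu.2]
    have hx : x 3 ≠ 0 := h3.ne'
    rw [← ENNReal.ofReal_mul h3.le]
    congr 1
    rw [show x 3 * u / x 3 = u by field_simp, show (1 - x 3 * u) / (x 3 - x 3 * u) = (1 - x 3 * u) / (x 3 * (1 - u)) by ring]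
    generalize reDilog u = R
    generalize Real.log ((1 - x 3 * u) / (x 3 * (1 - u))) = L2
    field_simp
  · have hfun3 : (fun s => G3 (Function.update x 1 s)) = fun _ => 0 := by
      funext s
      simp only [Function.update_self, Function.update_of_ne h31]
      rw [if_neg]
      intro h
      exact hC ⟨h.1.trans h.2.1, h.2.2⟩
    have hfun4 : (fun s => G4 (Function.update x 1 s)) = fun _ => 0 := by
      funext s
      simp only [Function.update_self, Function.update_of_ne h31]
      rw [if_neg]
      intro h
      exact hC h.2
    rw [hfun3, hfun4]

/-- Step 4 (`t₄ ∈ (0,1)`: the kernel `N(y)`). [folklore] -/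
theorem step4 (x : Fin 5 → ℝ) : ∫⁻ s, G4 (Function.update x 3 s) = G5 x := by
  have h13 : (1 : Fin 5) ≠ 3 := by decide
  by_cases hC : 0 < x 1 ∧ x 1 < 1
  · obtain ⟨h1, h1'⟩ := hC
    have hw := weight_nonneg h1 h1'
    have hfun : (fun s => G4 (Function.update x 3 s)) = (Ioo (0:ℝ) 1).indicator (fun s => ENNReal.ofReal
        ((Real.pi ^ 2 / 6 - reDilog (x 1)) / (1 - x 1) * (Real.log ((1 - s * x 1) / (s * (1 - x 1))) / (1 - s)))) := by
      funext s
      simp only [Set.indicator_apply, Set.mem_Ioo, Function.update_self, Function.update_of_ne h13]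
      by_cases hs : 0 < s ∧ s < 1
      · rw [if_pos ⟨⟨h1, h1'⟩, hs.1, hs.2⟩, if_pos hs]
      · rw [if_neg (fun h => hs h.2), if_neg hs]
    rw [hfun, lintegral_indicator measurableSet_Ioo, lintegral_N h1 h1' hw]
    simp only [if_pos (⟨h1, h1'⟩ : 0 < x 1 ∧ x 1 < 1)]
  · have hfun : (fun s => G4 (Function.update x 3 s)) = fun _ => 0 := by
      funext s
      simp only [Function.update_self, Function.update_of_ne h13]
      rw [if_neg]
      intro h
      exact hC h.1
    rw [hfun, lintegral_zero]; simp only [if_neg hC]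

/-- Step 5 (`y ∈ (0,1)`: the last integration `integral_last`). [folklore] -/
theorem step5 (x : Fin 5 → ℝ) : ∫⁻ s, G5 (Function.update x 1 s) = ENNReal.ofReal (2 * zetaValue 5 + 4 * zetaValue 3 * zetaValue 2) := by
  have hfun : (fun s => G5 (Function.update x 1 s)) = (Ioo (0:ℝ) 1).indicator (fun s => ENNReal.ofReal
      ((Real.pi ^ 2 / 6 - reDilog s) / (1 - s) * (Real.pi ^ 2 / 6 + reDilog s + Real.log (1 - s) ^ 2 / 2))) := by
    funext s
    simp only [Set.indicator_apply, Set.mem_Ioo, Function.update_self]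
  obtain ⟨hI, hv⟩ := integral_last
  have hnn : 0 ≤ᵐ[volume.restrict (Ioo (0:ℝ) 1)] fun s : ℝ =>
      (Real.pi ^ 2 / 6 - reDilog s) / (1 - s) * (Real.pi ^ 2 / 6 + reDilog s + Real.log (1 - s) ^ 2 / 2) :=
    (ae_restrict_mem measurableSet_Ioo).mono fun s hs => mul_nonneg (weight_nonneg hs.1 hs.2) (N_nonneg hs.1 hs.2)
  rw [hfun, lintegral_indicator measurableSet_Ioo, ← ofReal_integral_eq_lintegral_ofReal hI hnn, hv]

/-! ## 3. Assembly -/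

/-- One peeling step of the iterated integral (as in `WedgeDictionaryTopPairIntegral.peel`). [folklore] -/
private theorem peel' {s : Finset (Fin 5)} {i : Fin 5} (hi : i ∉ s) {f g : (Fin 5 → ℝ) → ENNReal} (hf : Measurable f)
    (h : ∀ x, ∫⁻ t, f (Function.update x i t) = g x) (x : Fin 5 → ℝ) :
    lmarginal (fun _ : Fin 5 => (volume : Measure ℝ)) (insert i s) f x =
      lmarginal (fun _ : Fin 5 => (volume : Measure ℝ)) s g x := by
  rw [lmarginal_insert' f hf hi]
  exact congrArg (fun F => lmarginal (fun _ : Fin 5 => (volume : Measure ℝ)) s F x) (funext h)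

/-- `θ = 2ζ(5) + 4ζ(3)ζ(2) ≥ 0`. [folklore] -/
theorem value_nonneg : 0 ≤ 2 * zetaValue 5 + 4 * zetaValue 3 * zetaValue 2 := by
  have h5 : 0 ≤ zetaValue 5 := tsum_nonneg fun n => by positivity
  have h3 : 0 ≤ zetaValue 3 := tsum_nonneg fun n => by positivity
  have h2 : 0 ≤ zetaValue 2 := tsum_nonneg fun n => by positivity
  positivity

/-- `∫ F0 = θ` over `ℝ⁵` (Tonelli: `t₁, t₅, t₃`, substitution `t₂ = t₄y`, `t₄`, `y`). [folklore] -/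
theorem lintegral_F0 : ∫⁻ t, F0 t = ENNReal.ofReal (2 * zetaValue 5 + 4 * zetaValue 3 * zetaValue 2) := by
  rw [MeasureTheory.volume_pi, lintegral_eq_lmarginal_univ (fun _ : Fin 5 => (0 : ℝ))]
  rw [show (Finset.univ : Finset (Fin 5)) = insert 0 {1, 2, 3, 4} from by decide,
    peel' (by decide) measurable_F0 step0,
    show ({1, 2, 3, 4} : Finset (Fin 5)) = insert 4 {1, 2, 3} from by decide,
    peel' (by decide) measurable_G1 step1,
    show ({1, 2, 3} : Finset (Fin 5)) = insert 2 {1, 3} from by decide,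
    peel' (by decide) measurable_G2 step2,
    lmarginal_insert' _ measurable_G3 (by decide : (1 : Fin 5) ∉ ({3} : Finset (Fin 5)))]
  simp_rw [step3]
  rw [← lmarginal_insert' _ measurable_G4 (by decide : (1 : Fin 5) ∉ ({3} : Finset (Fin 5))),
    show ({1, 3} : Finset (Fin 5)) = insert 3 {1} from by decide,
    peel' (by decide) measurable_G4 step4, lmarginal_singleton]
  exact step5 _

/-- `f0 ≥ 0` on the open simplex. [folklore] -/
theorem f0_nonneg {t : Fin 5 → ℝ} (ht : t ∈ openSimplex) : 0 ≤ f0 t := by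
  obtain ⟨h0, h01, h12, h23, h34, h4⟩ := ht
  obtain ⟨d20, d2, d3, d31⟩ : 0 < t 2 - t 0 ∧ 0 < t 2 ∧ 0 < 1 - t 3 ∧ 0 < t 3 - t 1 :=
    ⟨by linarith, by linarith, by linarith, by linarith⟩
  have d41 : 0 < t 4 - t 1 := by linarith
  beta_reduce
  positivity

/-- **Brown–Zudilin's base value `I₀ = 2ζ(5) + 4ζ(3)ζ(2)`**: the 5-fold cellular integral (1) at `a = (0,…,0)`,
`∫ dt/((t₃−t₁)t₃(1−t₄)(t₄−t₂)(t₅−t₂))` over `0 < t₁ < ⋯ < t₅ < 1`, equals `2ζ(5) + 4ζ(3)ζ(2)` exactly — the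
`n = 0` clause of the named fact `I_init` [BrownZudilin2022, Sect. 2, eq. (5)], here a theorem. [folklore] -/
theorem Isym_zero : Isym 0 = zeta5hat := by
  show cellularIntegral (fun _ => ((0 : ℕ) : ℤ)) = 2 * zetaValue 5 + 4 * zetaValue 3 * zetaValue 2
  unfold cellularIntegral
  simp_rw [integrand_zero]
  rw [integral_eq_lintegral_of_nonneg_ae (ae_restrict_of_forall_mem measurableSet_openSimplex' fun t ht => f0_nonneg ht)
    measurable_f0.aestronglyMeasurable, ← lintegral_indicator measurableSet_openSimplex']
  rw [show (∫⁻ t, openSimplex.indicator (fun t => ENNReal.ofReal (f0 t)) t) = _ from lintegral_F0,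
    ENNReal.toReal_ofReal value_nonneg]

/-- The same value for the literal parameter vector `(0,0,0,0,0,0,0,0)`. [folklore] -/
theorem cellularIntegral_zero : cellularIntegral ![0, 0, 0, 0, 0, 0, 0, 0] = 2 * zetaValue 5 + 4 * zetaValue 3 * zetaValue 2 := by
  have h := Isym_zero
  rw [Isym, zeta5hat] at h
  rw [← h]
  congr 1
  ext i; fin_cases i <;> rfl

end Summit.KontsevichZagierPeriods.Zeta5Search.CellularZetaFiveZero
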